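import Mathlib
import Summits.ValiantsHypothesis.ValiantsHypothesis.Theses.NewtonUnitEquations
import Summits.ValiantsHypothesis.ValiantsHypothesis.Theorems.NewtonUnitEquationsDissociatedFixedKExposedWord
import Summits.ValiantsHypothesis.ValiantsHypothesis.Theorems.NewtonUnitEquationsDissociatedFixedKThickness
import Summits.ValiantsHypothesis.ValiantsHypothesis.Theorems.NewtonUnitEquationsDissociatedFixedKTopTupleCount

/-!
# `NewtonUnitEquations.DissociatedFixedK` (stmt-ValiantsHypothesis-5907) — the crux, PROVED
(line `annihilator-product-functional`, `C(k) = 2k + 3`)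

Crux (route NewtonUnitEquations, rank 4):
`∀ k, ∃ C, ∀ m t (A : Fin m → Finset (Fin 2 →₀ ℕ)) (f : Fin k → Fin m → MvPolynomial (Fin 2) ℂ),
(∀ j, #A j ≤ t) → (∀ i j, supp f i j ⊆ A j) → (sum map injective on Π_j A j) →
#extremePoints (conv (emb '' supp (Σ_i Π_j f i j))) ≤ (m t + 2) ^ C`.

This file is the line's checked skeleton with its registered stubs now landed theorems:
* `stub_exposedWord` (`…DissociatedFixedKExposedWord.lean`): every vertex is `emb (Σ_j a_j)` for a
  surviving frame word `a`, strictly exposed by a functional `l` among the other surviving words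
  (blueprint steps 1–2: dictionary under dissociation + Hahn–Banach);
* `stub_thicknessFit` (`…DissociatedFixedKThickness.lean`): the annihilating product functional —
  a word `b` letterwise `l`-above `a` and alive wherever `a`'s alive products are differs from `a` in
  `< k` coordinates (blueprint step 3, the line's lever);
* `stub_topTupleCount` (`…DissociatedFixedKTopTupleCount.lean`): the tuples of lex-`l`-tops of letter
  sets of size `≤ t` number `≤ 4 (m t)² + 7` over all functionals `l` (step 4), through its registered
  sub-goal `stub_cmpPatCount` (`…DissociatedFixedKSweep.lean`: comparison patterns on a finite planar set).
The assembly below (alive pattern / alive box / lex tops / slot-list encoding `word`, `canon` / finset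
cover / `count_arith`) then bounds the vertices by `2^k (m t + 1)^k (4 (m t)² + 7) ≤ (m t + 2)^(2k+3)`.
Sharpness/limits (disprover, `Theorems/DissociatedFixedK/Negative/`): the hypotheses `#A j ≤ t` and
`supp ⊆ A j` are load-bearing (`dissociatedFixedK_false_without_card/supp`), thickness `k - 1` is attained
(`cube_lemma_sharp_one/two`), and no `C` uniform in `k` exists (KPTT Example 3), so `C(k) → ∞` is forced.
[folklore; setting KPTT arXiv:1308.2286 §2]
-/

namespace Summit.ValiantsHypothesis.Theorems

open scoped BigOperators Classical

noncomputable section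

namespace DissociatedFixedK

/-! ## Encoding helpers for the assembly -/

/-- Decode: the letter for coordinate `j` is read off the slot list `L` (any slot carrying `j`),
defaulting to `b j` when no slot carries `j`. -/
def word {k m : ℕ} (L : Fin k → Option (Fin m × (Fin 2 →₀ ℕ)))
    (b : Fin m → (Fin 2 →₀ ℕ)) (j : Fin m) : Fin 2 →₀ ℕ :=
  if h : ∃ s : Fin k, ∃ e : Fin 2 →₀ ℕ, L s = some (j, e) then (Classical.choose_spec h).choose
  else b j

/-- Decoding is correct: a faithful slot list covering `j` (or agreeing default) returns `a j`. -/
theorem word_eq {k m : ℕ} {L : Fin k → Option (Fin m × (Fin 2 →₀ ℕ))}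
    {b a : Fin m → (Fin 2 →₀ ℕ)} {j : Fin m}
    (hfaith : ∀ (s : Fin k) (e : Fin 2 →₀ ℕ), L s = some (j, e) → e = a j)
    (hcov : (∃ s : Fin k, ∃ e : Fin 2 →₀ ℕ, L s = some (j, e)) ∨ b j = a j) :
    word L b j = a j := by
  unfold word
  split_ifs with h
  · exact hfaith _ _ (Classical.choose_spec h).choose_spec
  · rcases hcov with h' | h'
    · exact absurd h' h
    · exact h'

/-- Encode: the canonical slot list of a coordinate set `J` (in increasing order) with the letters of
`a`, padded with `none`. -/
def canon {k m : ℕ} (J : Finset (Fin m)) (a : Fin m → (Fin 2 →₀ ℕ)) (s : Fin k) :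
    Option (Fin m × (Fin 2 →₀ ℕ)) :=
  if h : (s : ℕ) < J.card then
    some (J.orderEmbOfFin rfl ⟨s, h⟩, a (J.orderEmbOfFin rfl ⟨s, h⟩))
  else none

/-- The canonical slot list at a slot below `#J`. -/
theorem canon_apply_of_eq {k m : ℕ} (J : Finset (Fin m)) (a : Fin m → (Fin 2 →₀ ℕ)) (s : Fin k)
    (r : Fin J.card) (hs : (s : ℕ) = r) :
    canon J a s = some (J.orderEmbOfFin rfl r, a (J.orderEmbOfFin rfl r)) := by
  have h : (s : ℕ) < J.card := hs ▸ r.2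
  unfold canon
  rw [dif_pos h]
  have e1 : (⟨(s : ℕ), h⟩ : Fin J.card) = r := Fin.ext hs
  rw [e1]

/-- The canonical slot list only carries pairs `(j, a j)` with `j ∈ J`. -/
theorem canon_faithful {k m : ℕ} {J : Finset (Fin m)} {a : Fin m → (Fin 2 →₀ ℕ)} {s : Fin k}
    {j : Fin m} {e : Fin 2 →₀ ℕ} (hs : canon J a s = some (j, e)) : j ∈ J ∧ e = a j := by
  unfold canon at hs
  by_cases h : (s : ℕ) < J.card
  · rw [dif_pos h] at hs
    simp only [Option.some.injEq, Prod.mk.injEq] at hs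
    obtain ⟨hj, he⟩ := hs
    subst hj
    exact ⟨Finset.orderEmbOfFin_mem _ _ _, he.symm⟩
  · rw [dif_neg h] at hs
    exact absurd hs (by simp)

/-- Every `j ∈ J` is carried by some slot when `#J ≤ k`. -/
theorem canon_covers {k m : ℕ} {J : Finset (Fin m)} {a : Fin m → (Fin 2 →₀ ℕ)} {j : Fin m}
    (hj : j ∈ J) (hJ : J.card ≤ k) :
    ∃ s : Fin k, ∃ e : Fin 2 →₀ ℕ, canon J a s = some (j, e) := by
  have hr : j ∈ Set.range (J.orderEmbOfFin rfl) := by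
    rw [Finset.range_orderEmbOfFin, Finset.mem_coe]
    exact hj
  obtain ⟨r, hr⟩ := hr
  refine ⟨⟨r, lt_of_lt_of_le r.2 hJ⟩, a j, ?_⟩
  rw [canon_apply_of_eq J a ⟨r, lt_of_lt_of_le r.2 hJ⟩ r rfl, hr]

/-- The canonical slot list takes values in the finite alphabet `none ∪ {(j, e) : e ∈ A j}`. -/
theorem canon_mem {k m : ℕ} (A : Fin m → Finset (Fin 2 →₀ ℕ)) {J : Finset (Fin m)}
    {a : Fin m → (Fin 2 →₀ ℕ)} (ha : ∀ j, a j ∈ A j) (s : Fin k) :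
    canon J a s ∈ Finset.insertNone (Finset.univ.biUnion fun j => (A j).image (Prod.mk j)) := by
  unfold canon
  by_cases h : (s : ℕ) < J.card
  · rw [dif_pos h, Finset.some_mem_insertNone]
    refine Finset.mem_biUnion.2 ⟨J.orderEmbOfFin rfl ⟨s, h⟩, Finset.mem_univ _, ?_⟩
    exact Finset.mem_image.2 ⟨_, ha _, rfl⟩
  · rw [dif_neg h]
    exact Finset.none_mem_insertNone

/-- The final arithmetic: `2^k (mt+1)^k (4(mt)²+7) ≤ (mt+2)^(2k+3)`. -/
theorem count_arith (k m t : ℕ) :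
    2 ^ k * ((m * t + 1) ^ k * (4 * (m * t) ^ 2 + 7)) ≤ (m * t + 2) ^ (2 * k + 3) := by
  have h2k : 2 ^ k ≤ (m * t + 2) ^ k := Nat.pow_le_pow_left (by omega) k
  have hmk : (m * t + 1) ^ k ≤ (m * t + 2) ^ k := Nat.pow_le_pow_left (by omega) k
  have hlast : 4 * (m * t) ^ 2 + 7 ≤ (m * t + 2) ^ 3 := by
    have e : (m * t + 2) ^ 3 = (m * t) ^ 3 + 6 * (m * t) ^ 2 + 12 * (m * t) + 8 := by ring
    rw [e]
    have h0 : 0 ≤ (m * t) ^ 3 := Nat.zero_le _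
    omega
  calc 2 ^ k * ((m * t + 1) ^ k * (4 * (m * t) ^ 2 + 7))
      ≤ (m * t + 2) ^ k * ((m * t + 2) ^ k * (m * t + 2) ^ 3) :=
        Nat.mul_le_mul h2k (Nat.mul_le_mul hmk hlast)
    _ = (m * t + 2) ^ (2 * k + 3) := by ring

end DissociatedFixedK

/-! ## The crux `DissociatedFixedK` BY NAME -/

open DissociatedFixedK in
/-- **`NewtonUnitEquations.DissociatedFixedK` holds** (crux stmt-ValiantsHypothesis-5907, line
`annihilator-product-functional`), with `C = 2k + 3`: for every `k` and every dissociated frame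
(`supp f i j ⊆ A j`, `#A j ≤ t`, sum map injective on `Π_j A j`) the Newton polygon of
`Σ_{i<k} Π_{j<m} f i j` has at most `(m t + 2) ^ (2k+3)` vertices.  Assembly of the landed stubs:
for a vertex `p` take `(a, l)` from `stub_exposedWord`, the alive pattern `I = {i : ∀ j, c i j (a j) ≠ 0}`,
the alive box `C I j = {e ∈ A j : ∀ i ∈ I, c i j e ≠ 0} ∋ a j`, and `b j` a lex-key-maximal letter of
`C I j`; `stub_thicknessFit` gives `#{j : b j ≠ a j} < k`, so `a` is `b` overwritten by `< k`
(coordinate, letter) pairs; encoding `p ↦ (I, slot list, b)` covers the vertex set by a finset of size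
`≤ 2^k · (m t + 1)^k · (4 (m t)² + 7) ≤ (m t + 2)^(2k+3)` (`stub_topTupleCount`, `count_arith`).
[folklore; setting KPTT arXiv:1308.2286 §2] -/
theorem dissociatedFixedK_proof :
    Summit.ValiantsHypothesis.ValiantsHypothesis.Theses.NewtonUnitEquations.DissociatedFixedK := by
  intro k
  refine ⟨2 * k + 3, ?_⟩
  intro m t A f hA hf hinj
  -- the coefficient tensor and the alive boxes `C I j`
  set c : Fin k → Fin m → (Fin 2 →₀ ℕ) → ℂ := fun i j e => (f i j).coeff e with hc
  set C : Finset (Fin k) → Fin m → Finset (Fin 2 →₀ ℕ) := fun I j =>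
    (A j).filter fun e => ∀ i ∈ I, c i j e ≠ 0 with hC
  have hCA : ∀ I j, C I j ⊆ A j := fun I j => Finset.filter_subset _ _
  have hCcard : ∀ I j, (C I j).card ≤ t := fun I j => (Finset.card_le_card (hCA I j)).trans (hA j)
  -- the box tops of pattern `I` (over all functionals), counted by `stub_topTupleCount`
  set BT : Finset (Fin k) → Finset (Fin m → (Fin 2 →₀ ℕ)) := fun I =>
    (Fintype.piFinset (C I)).filter fun b : Fin m → (Fin 2 →₀ ℕ) =>
      ∃ l : (Fin 2 → ℝ) →L[ℝ] ℝ, ∀ j, ∀ e ∈ C I j,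
        (toLex (l (fun i : Fin 2 => ((e i : ℕ) : ℝ)), toLex (e 0, e 1)) : Lex (ℝ × Lex (ℕ × ℕ)))
          ≤ toLex (l (fun i : Fin 2 => (((b j) i : ℕ) : ℝ)), toLex ((b j) 0, (b j) 1)) with hBT
  have hBTcard : ∀ I, (BT I).card ≤ 4 * (m * t) ^ 2 + 7 := fun I =>
    stub_topTupleCount m t (C I) (hCcard I)
  -- the letters and the slot lists
  set LET : Finset (Fin m × (Fin 2 →₀ ℕ)) :=
    Finset.univ.biUnion fun j => (A j).image (Prod.mk j) with hLET
  set LST : Finset (Fin k → Option (Fin m × (Fin 2 →₀ ℕ))) :=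
    Fintype.piFinset fun _ => Finset.insertNone LET with hLST
  have hLETcard : LET.card ≤ m * t := by
    calc LET.card ≤ ∑ j, ((A j).image (Prod.mk j)).card := Finset.card_biUnion_le
      _ ≤ ∑ _j : Fin m, t := Finset.sum_le_sum fun j _ => Finset.card_image_le.trans (hA j)
      _ = m * t := by simp
  have hLSTcard : LST.card ≤ (m * t + 1) ^ k := by
    have e : LST.card = (LET.card + 1) ^ k := by
      simp only [hLST, Fintype.card_piFinset, Finset.card_insertNone, Finset.prod_const,
        Finset.card_univ, Fintype.card_fin]
    rw [e]
    exact Nat.pow_le_pow_left (by omega) k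
  -- the covering finset
  set U : Finset (Fin 2 → ℝ) := (Finset.univ : Finset (Finset (Fin k))).biUnion fun I =>
    LST.biUnion fun L => (BT I).image fun b =>
      (fun i : Fin 2 => (((∑ j, word L b j) i : ℕ) : ℝ)) with hU
  have hUcard : U.card ≤ 2 ^ k * ((m * t + 1) ^ k * (4 * (m * t) ^ 2 + 7)) := by
    calc U.card
        ≤ ∑ I : Finset (Fin k), (LST.biUnion fun L => (BT I).image fun b =>
            (fun i : Fin 2 => (((∑ j, word L b j) i : ℕ) : ℝ))).card := Finset.card_biUnion_le
      _ ≤ ∑ I : Finset (Fin k), ∑ L ∈ LST, ((BT I).image fun b =>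
            (fun i : Fin 2 => (((∑ j, word L b j) i : ℕ) : ℝ))).card :=
          Finset.sum_le_sum fun I _ => Finset.card_biUnion_le
      _ ≤ ∑ I : Finset (Fin k), ∑ L ∈ LST, (4 * (m * t) ^ 2 + 7) :=
          Finset.sum_le_sum fun I _ => Finset.sum_le_sum fun L _ =>
            Finset.card_image_le.trans (hBTcard I)
      _ = Fintype.card (Finset (Fin k)) * (LST.card * (4 * (m * t) ^ 2 + 7)) := by
          simp only [Finset.sum_const, smul_eq_mul, Finset.card_univ]
      _ ≤ 2 ^ k * ((m * t + 1) ^ k * (4 * (m * t) ^ 2 + 7)) := by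
          rw [Fintype.card_finset, Fintype.card_fin]
          exact Nat.mul_le_mul_left _ (Nat.mul_le_mul_right _ hLSTcard)
  -- every vertex is covered
  have hcover : Set.extremePoints ℝ (convexHull ℝ
      ((fun e : Fin 2 →₀ ℕ => fun i : Fin 2 => ((e i : ℕ) : ℝ)) ''
        ((∑ i, ∏ j, f i j).support : Set (Fin 2 →₀ ℕ)))) ⊆ ↑U := by
    intro p hp
    obtain ⟨a, l, ha, hpa, hTa, htop⟩ := stub_exposedWord A f hf hinj p hp
    -- alive pattern of `a` and its box
    set I : Finset (Fin k) := Finset.univ.filter fun i => ∀ j, c i j (a j) ≠ 0 with hI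
    have haC : ∀ j, a j ∈ C I j := by
      intro j
      refine Finset.mem_filter.2 ⟨ha j, fun i hi => ?_⟩
      exact (Finset.mem_filter.1 hi).2 j
    -- coordinatewise lexicographic tops of the box
    have hex : ∀ j, ∃ bj ∈ C I j, ∀ e ∈ C I j,
        (toLex (l (fun i : Fin 2 => ((e i : ℕ) : ℝ)), toLex (e 0, e 1)) : Lex (ℝ × Lex (ℕ × ℕ)))
          ≤ toLex (l (fun i : Fin 2 => ((bj i : ℕ) : ℝ)), toLex (bj 0, bj 1)) := fun j =>
      Finset.exists_max_image (C I j)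
        (fun e : Fin 2 →₀ ℕ =>
          (toLex (l (fun i : Fin 2 => ((e i : ℕ) : ℝ)), toLex (e 0, e 1)) : Lex (ℝ × Lex (ℕ × ℕ))))
        ⟨a j, haC j⟩
    choose b hbC hbmax using hex
    have hbA : ∀ j, b j ∈ A j := fun j => hCA I j (hbC j)
    have hba : ∀ j, l (fun i : Fin 2 => (((a j) i : ℕ) : ℝ)) ≤ l (fun i : Fin 2 => (((b j) i : ℕ) : ℝ)) := by
      intro j
      have h := hbmax j (a j) (haC j)
      rw [Prod.Lex.toLex_le_toLex] at h
      rcases h with h | ⟨h, _⟩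
      · exact h.le
      · exact h.le
    have hbI : ∀ i, (∀ j, c i j (a j) ≠ 0) → ∀ j, c i j (b j) ≠ 0 := by
      intro i hi j
      have hiI : i ∈ I := Finset.mem_filter.2 ⟨Finset.mem_univ _, hi⟩
      exact (Finset.mem_filter.1 (hbC j)).2 i hiI
    -- thickness (the lever)
    have hthick : (Finset.univ.filter fun j => b j ≠ a j).card < k :=
      stub_thicknessFit A c l a b ha hbA hTa htop hbI hba
    set J : Finset (Fin m) := Finset.univ.filter fun j => b j ≠ a j with hJ
    -- decoding the canonical slot list of `(J, a)` against `b` returns `a`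
    have hword : ∀ j, word (canon (k := k) J a) b j = a j := by
      intro j
      apply word_eq (a := a)
      · intro s e hs
        exact (canon_faithful hs).2
      · by_cases hj : j ∈ J
        · exact Or.inl (canon_covers hj hthick.le)
        · right
          by_contra hne
          exact hj (Finset.mem_filter.2 ⟨Finset.mem_univ _, hne⟩)
    have hsum : (∑ j, word (canon (k := k) J a) b j) = ∑ j, a j :=
      Finset.sum_congr rfl fun j _ => hword j
    -- membership in the covering finset
    rw [Finset.mem_coe]
    refine Finset.mem_biUnion.2 ⟨I, Finset.mem_univ _, ?_⟩
    refine Finset.mem_biUnion.2 ⟨canon (k := k) J a, ?_, ?_⟩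
    · exact Fintype.mem_piFinset.2 fun s => canon_mem A ha s
    · refine Finset.mem_image.2 ⟨b, ?_, ?_⟩
      · exact Finset.mem_filter.2 ⟨Fintype.mem_piFinset.2 hbC, l, fun j e he => hbmax j e he⟩
      · rw [hpa, hsum]
  -- conclude
  calc (Set.extremePoints ℝ (convexHull ℝ
          ((fun e : Fin 2 →₀ ℕ => fun i : Fin 2 => ((e i : ℕ) : ℝ)) ''
            ((∑ i, ∏ j, f i j).support : Set (Fin 2 →₀ ℕ))))).ncard
      ≤ (↑U : Set (Fin 2 → ℝ)).ncard := Set.ncard_le_ncard hcover U.finite_toSet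
    _ = U.card := Set.ncard_coe_finset U
    _ ≤ 2 ^ k * ((m * t + 1) ^ k * (4 * (m * t) ^ 2 + 7)) := hUcard
    _ ≤ (m * t + 2) ^ (2 * k + 3) := count_arith k m t

end

end Summit.ValiantsHypothesis.Theorems
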